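import Literature.Geometry.Kaehler.LelongTheorem
import Literature.Geometry.Kaehler.ComplexFrameOrientation
import Literature.Geometry.Kaehler.AnalyticSetHausdorffNull
import Literature.Analysis.Calculus.AreaFormulaHausdorff
import Literature.Geometry.GeometricMeasureTheory.PullbackStokes
import Literature.Analysis.Complex.OsgoodProofs
import Mathlib.Topology.Baire.Lemmas
import Mathlib.Topology.Baire.LocallyCompactRegular
import Mathlib.LinearAlgebra.Complex.FiniteDimensional
import HarnessLib

/-!
# `d[T] = 0` near the regular points of a holomorphic chain

Brick R8 of the proof of the named fact
`Literature.Geometry.Kaehler.Harvey1977_boundary_toCurrent_eq_zero` [Harvey1977, Lemma 1.8]: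
Harvey's first step "Let `Sing V` denote the singular locus of `V = supp T`. Of course, `dT = 0` on
`Ω - Sing V`" [Harvey1977, proof of Lemma 1.8, p. 320] — Stokes' theorem on the complex manifold
`Reg V`, which has no boundary inside `Ω - Sing V` — for the current
`[T] = ∫_{reg |T|} θ_T ⟨·, ξ_T⟩ d𝓗^{2p}` of `HolomorphicChain.lean`.

Let `T` be a holomorphic `p`-chain on the open set `Ω ⊆ V` and `x₀ ∈ reg |T|` (a point of the
carrier). In a straightened chart `Ψ₀ : B = ball 0 ρ ⊆ K → |T| ∩ N` at `x₀`
(`SCV.IsRegPt.exists_straightParam`, `K = ker dg(x₀)` a complex `p`-plane, `π (Ψ₀ k - x₀) = k`):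

* `SCV.forall_mem_of_isZeroSetAt_of_ball_subset` — **identity principle along `Ψ₀`**: a set `S`
  which is locally the zero set of holomorphic functions near the points `Ψ₀ k`, and which contains
  `Ψ₀` of a small ball, contains `Ψ₀(B)` (Osgood: holomorphic ⇒ analytic, and the identity principle
  for analytic functions on the connected ball);
* `HolomorphicChain.exists_ae_density_eq_of_chart` — **the density `θ_T` is a.e. constant on the
  chart**: the finitely many components `Aⱼ` meeting a compact neighbourhood cover the connected
  manifold `|T| ∩ N = Ψ₀(B)`; by Baire one of them, `A₀`, contains `Ψ₀` of a small ball, hence all of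
  `Ψ₀(B)` (identity principle), and the other components meet `A₀` in an `𝓗^{2p}`-null set
  [Chirka1989, §5.3 Cor. 1], so `θ_T = k₀` a.e. on `|T| ∩ N`;
* `HolomorphicChain.exists_orientationFrame_eq_complexFrame_of_chart` — on the chart the orientation
  frame `ξ_T(Ψ₀ k)` is the real frame of a unitary frame of `im DΨ₀(k)`;
* `HolomorphicChain.toCurrent_extDeriv_eq_zero_of_tsupport_subset` — **`[T](dψ) = 0` for test forms
  `ψ` supported in the chart domain `N`**:
  `[T](dψ) = k₀ ∫_{Ψ₀(B)} dψ(ξ_T) d𝓗^{2p} = k₀ ∫_B J(DΨ₀) dψ(ξ_T ∘ Ψ₀) dk` (area formula,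
  `Literature.Analysis.Calculus.integral_image_eq_integral_normDet_smul`)
  `= k₀ ∫_B (Ψ₀^* dψ)(e) dk` (`J(DΨ₀(k)) dψ(ξ_T) = dψ(DΨ₀(k) e)` for the real frame `e` of a unitary
  basis of `K`: the canonical orientation, `apply_comp_complexFrame_eq_normDet_mul`) `= 0`
  (Stokes for compactly supported exact forms on `K`, `integral_extDeriv_pullback_eq_zero`);
* `HolomorphicChain.exists_nhds_boundary_apply_eq_zero` — hence every point of the carrier has a
  neighbourhood `U` with `d[T](ψ) = 0` whenever `spt ψ ⊆ U`.

## References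

* R. Harvey, *Holomorphic chains and their boundaries*, PSPUM XXX.1 (1977), Lemma 1.8 (p. 320)
  (held: `lit galaxy panama:376316444541009`, p. 280 of the scan).
* E. M. Chirka, *Complex Analytic Sets*, Kluwer 1989, §14.2 Prop. 3 (proof), §5.3 Cor. 1.
* H. Federer, *Geometric Measure Theory*, Springer 1969, 3.2.3, 4.1.7.
-/

open scoped Manifold Topology ENNReal NNReal
open Set Filter MeasureTheory Metric Function

namespace Literature.Geometry.Kaehler

/-! ### Identity principle along a holomorphic parametrisation -/

namespace SCV

open Literature.Analysis.Complex.SCV (IsZeroSetAt)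

variable {K : Type*} [NormedAddCommGroup K] [NormedSpace ℂ K] [FiniteDimensional ℂ K]
  {E : Type*} [NormedAddCommGroup E] [NormedSpace ℂ E]

/-- **Identity principle along a holomorphic parametrisation.** Let `Ψ` be holomorphic on the
ball `B = ball 0 ρ` of a finite-dimensional complex space `K`, and `S ⊆ E` a set which, near each
point `Ψ k` (`k ∈ B`), is the common zero set of finitely many holomorphic functions. If `Ψ` maps
some small ball `ball k₀ ε ⊆ B` into `S`, then it maps all of `B` into `S`: the set of `k ∈ B`
near which `Ψ` maps into `S` is open, nonempty, and relatively closed (Osgood's lemma — holomorphic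
functions of several variables are analytic, `Literature.Analysis.Complex.SCV.analyticOnNhd_of_differentiableOn` —
and the identity principle for analytic functions on balls), and `B` is connected.
[cite: Chirka1989, §5.3 (uniqueness theorem) and A1.1] -/
theorem forall_mem_of_isZeroSetAt_of_ball_subset {Ψ : K → E} {ρ : ℝ}
    (hΨ : DifferentiableOn ℂ Ψ (ball 0 ρ)) {S : Set E}
    (hS : ∀ k ∈ ball (0 : K) ρ, IsZeroSetAt S (Ψ k)) {k₀ : K} {ε : ℝ} (hε : 0 < ε)
    (hsub : ball k₀ ε ⊆ ball 0 ρ) (hin : ∀ k ∈ ball k₀ ε, Ψ k ∈ S) :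
    ∀ k ∈ ball (0 : K) ρ, Ψ k ∈ S := by
  -- the set of points near which `Ψ` maps into `S`
  set I : Set K := {k | ∃ δ > 0, ball k δ ⊆ ball 0 ρ ∧ ∀ k' ∈ ball k δ, Ψ k' ∈ S} with hI
  have hIo : IsOpen I := by
    refine Metric.isOpen_iff.2 ?_
    rintro k ⟨δ, hδ, hδρ, hδS⟩
    refine ⟨δ / 2, by positivity, fun k₁ hk₁ => ⟨δ / 2, by positivity, fun k' hk' => hδρ ?_,
      fun k' hk' => hδS k' ?_⟩⟩ <;>
    · rw [mem_ball] at hk₁ hk' ⊢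
      linarith [dist_triangle k' k₁ k]
  -- it is relatively closed in the ball: identity principle
  have hcl : closure I ∩ ball 0 ρ ⊆ I := by
    rintro k ⟨hkI, hk⟩
    obtain ⟨U, hUo, hkU, N, g, hg, hSU⟩ := hS k hk
    have hW : ball 0 ρ ∩ Ψ ⁻¹' U ∈ 𝓝 k :=
      (hΨ.continuousOn.isOpen_inter_preimage isOpen_ball hUo).mem_nhds ⟨hk, hkU⟩
    obtain ⟨δ, hδ, hδW⟩ := Metric.mem_nhds_iff.1 hW
    obtain ⟨k₁, hk₁δ, hk₁I⟩ : (ball k δ ∩ I).Nonempty :=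
      mem_closure_iff_nhds.1 hkI _ (ball_mem_nhds k hδ)
    obtain ⟨δ₁, hδ₁, -, hδ₁S⟩ := hk₁I
    -- `g ∘ Ψ` is holomorphic on `ball k δ` and vanishes near `k₁`, hence on `ball k δ`
    have hcomp : DifferentiableOn ℂ (g ∘ Ψ) (ball k δ) :=
      hg.comp (hΨ.mono fun k' hk' => (hδW hk').1) fun k' hk' => (hδW hk').2
    have han := Literature.Analysis.Complex.SCV.analyticOnNhd_of_differentiableOn hcomp isOpen_ball
    have hev : (g ∘ Ψ) =ᶠ[𝓝 k₁] 0 := by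
      filter_upwards [ball_mem_nhds k₁ hδ₁, isOpen_ball.mem_nhds hk₁δ] with k' hk'₁ hk'δ
      have h1 : Ψ k' ∈ S ∩ U := ⟨hδ₁S k' hk'₁, (hδW hk'δ).2⟩
      rw [hSU] at h1
      exact h1.2
    have hzero := han.eqOn_zero_of_preconnected_of_eventuallyEq_zero
      (convex_ball k δ).isPreconnected hk₁δ hev
    refine ⟨δ, hδ, fun k' hk' => (hδW hk').1, fun k' hk' => ?_⟩
    have h1 : Ψ k' ∈ U ∩ g ⁻¹' {0} := ⟨(hδW hk').2, hzero hk'⟩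
    rw [← hSU] at h1
    exact h1.1
  -- the ball is connected
  have hk₀ρ : k₀ ∈ ball (0 : K) ρ := hsub (mem_ball_self hε)
  have hall : ball (0 : K) ρ ⊆ I :=
    (convex_ball (0 : K) ρ).isPreconnected.subset_of_closure_inter_subset hIo
      ⟨k₀, hk₀ρ, ε, hε, hsub, hin⟩ hcl
  intro k hk
  obtain ⟨δ, hδ, -, hδS⟩ := hall hk
  exact hδS k (mem_ball_self hδ)

end SCV

/-! ### The density and the orientation of `[T]` along a straightened chart -/

namespace HolomorphicChain

open Literature.Geometry.GeometricMeasureTheory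
open Literature.Analysis.Complex.SCV (IsZeroSetAt)

-- Nested operator-norm instances on `Covector V m`, as in `Currents.lean`.
set_option maxSynthPendingDepth 2

variable {V : Type*} [NormedAddCommGroup V] [InnerProductSpace ℂ V] [FiniteDimensional ℂ V]
  [MeasurableSpace V] [BorelSpace V] {Ω : TopologicalSpace.Opens V} {p : ℕ}

/-- **The density of `[T]` is a.e. constant along a straightened chart.** Let
`Ψ₀ : B = ball 0 ρ → V` be holomorphic with `Ψ₀(B) = |T| ∩ N`, where `N` lies in a compact subset
`Kc` of `Ω`. Then there is an integer `k₀` with `θ_T = k₀` for `𝓗^{2p}`-almost every point of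
`reg |T| ∩ N` (`= |T| ∩ N`). Indeed the finitely many components `Aⱼ` of `T` meeting `Kc`
(`finite_inter_compact`) cover `Ψ₀(B)`; their preimages are relatively closed and cover the ball, so
by Baire one of them, `A₀`, contains `Ψ₀` of a small ball, hence `Ψ₀(B) ⊆ A₀` by the identity
principle (`SCV.forall_mem_of_isZeroSetAt_of_ball_subset`); and `θ_T = mult A₀` at the points of
`A₀` on no other component (`multAt_eq_mult`), the exceptional set `⋃_{j} Aⱼ ∩ A₀` being
`𝓗^{2p}`-null (`IsIrreducibleAnalyticSet.euclideanHausdorffMeasure_image_inter_eq_zero`,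
[Chirka1989, §5.3 Cor. 1]). This is the local constancy of the multiplicity on `Reg V` behind
"`dT = 0` on `Ω - Sing V`" (cf. Harvey's proof of Lemma 1.9: "`f` must be locally constant, say
`f ≡ c_j` on the component `W_j` of `Reg V`"). [cite: Harvey1977, Lemmas 1.8–1.9 (proofs, p. 320);
Chirka1989, §14.2 Prop. 3 (proof)] -/
theorem exists_ae_density_eq_of_chart (T : HolomorphicChain 𝓘(ℂ, V) Ω p) {N : Set V} {q : ℕ}
    {g : V → (Fin q → ℂ)} {K : Submodule ℂ V} {ρ : ℝ} {Ψ₀ : K → V}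
    (hNo : IsOpen N) (hg : DifferentiableOn ℂ g N)
    (hgZ : ∀ z ∈ N, z ∈ ((↑) : Ω → V) '' T.support ↔ g z = 0)
    (hsurj : ∀ z ∈ N, Function.Surjective (fderiv ℂ g z)) (hρ : 0 < ρ)
    (hΨ : DifferentiableOn ℂ Ψ₀ (ball 0 ρ))
    (himage : Ψ₀ '' ball 0 ρ = ((↑) : Ω → V) '' T.support ∩ N)
    {Kc : Set V} (hKc : IsCompact Kc) (hKΩ : Kc ⊆ (Ω : Set V)) (hNK : N ⊆ Kc) :
    ∃ k₀ : ℤ, ∀ᵐ y ∂((μHE[2 * p] : Measure V).restrict (T.carrier ∩ N)), T.density y = k₀ := by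
  classical
  haveI : LocallyCompactSpace Ω := Ω.isOpen.locallyCompactSpace
  set Z : Set V := ((↑) : Ω → V) '' T.support with hZ
  have hcarN : T.carrier ∩ N = Z ∩ N := T.carrier_inter_eq_of_chart hNo hg hgZ hsurj
  have hballZN : ∀ k ∈ ball (0 : K) ρ, Ψ₀ k ∈ Z ∩ N := fun k hk =>
    himage ▸ mem_image_of_mem Ψ₀ hk
  -- the finitely many components meeting `Kc`
  have hK' : IsCompact (((↑) : Ω → V) ⁻¹' Kc) := by
    rw [Topology.IsEmbedding.subtypeVal.isCompact_iff]
    have : ((↑) : Ω → V) '' (((↑) : Ω → V) ⁻¹' Kc) = Kc := by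
      rw [image_preimage_eq_inter_range, Subtype.range_coe, inter_eq_left.2 hKΩ]
    rwa [this]
  have hfin := T.finite_inter_compact hK'
  set F : Finset (Set Ω) := hfin.toFinset with hF
  have hFmem : ∀ {A : Set Ω}, A ∈ F ↔ T.mult A ≠ 0 ∧ ((((↑) : Ω → V) ⁻¹' Kc) ∩ A).Nonempty :=
    fun {A} => hfin.mem_toFinset
  have hFan : ∀ {A : Set Ω}, A ∈ F → IsAnalyticSet 𝓘(ℂ, V) A := fun hA =>
    (T.isIrreducibleAnalyticSet_of_mult_ne_zero (hFmem.1 hA).1).1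
  -- every point of the chart lies on a component from `F`
  have hcover : ∀ k ∈ ball (0 : K) ρ, ∃ A ∈ F, Ψ₀ k ∈ ((↑) : Ω → V) '' A := by
    intro k hk
    obtain ⟨⟨w, hw, hwk⟩, hkN⟩ := hballZN k hk
    obtain ⟨A, hA, hwA⟩ := mem_support_iff.1 hw
    refine ⟨A, hFmem.2 ⟨hA, w, ?_, hwA⟩, w, hwA, hwk⟩
    show (w : V) ∈ Kc
    rw [hwk]; exact hNK hkN
  have hΩ_of_ball : ∀ k ∈ ball (0 : K) ρ, Ψ₀ k ∈ (Ω : Set V) := fun k hk => by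
    obtain ⟨⟨w, -, hwk⟩, -⟩ := hballZN k hk
    rw [← hwk]; exact w.2
  -- Baire: some component contains `Ψ₀` of a small ball
  obtain ⟨A₀, hA₀F, k₀, ε, hε, hsub, hin⟩ : ∃ A₀ ∈ F, ∃ (k₀ : K) (ε : ℝ), 0 < ε ∧
      ball k₀ ε ⊆ ball 0 ρ ∧ ∀ k ∈ ball k₀ ε, Ψ₀ k ∈ ((↑) : Ω → V) '' A₀ := by
    haveI : LocallyCompactSpace (ball (0 : K) ρ) := isOpen_ball.locallyCompactSpace
    haveI : Nonempty (ball (0 : K) ρ) := ⟨⟨0, mem_ball_self hρ⟩⟩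
    have hcont : Continuous (Ψ₀ ∘ ((↑) : ball (0 : K) ρ → K)) :=
      hΨ.continuousOn.comp_continuous continuous_subtype_val fun k => k.2
    set f : F → Set (ball (0 : K) ρ) := fun A =>
      (Ψ₀ ∘ ((↑) : ball (0 : K) ρ → K)) ⁻¹' closure (((↑) : Ω → V) '' (A : Set Ω)) with hf
    have hfc : ∀ A, IsClosed (f A) := fun A => isClosed_closure.preimage hcont
    have hfU : ⋃ A, f A = univ := by
      refine eq_univ_of_forall fun k => ?_
      obtain ⟨A, hA, hkA⟩ := hcover k k.2
      exact mem_iUnion.2 ⟨⟨A, hA⟩, subset_closure hkA⟩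
    obtain ⟨⟨A₀, hA₀F⟩, k₁, hk₁⟩ := nonempty_interior_of_iUnion_of_closed hfc hfU
    rw [mem_interior_iff_mem_nhds, mem_nhds_subtype] at hk₁
    obtain ⟨u, hu, huf⟩ := hk₁
    obtain ⟨ε₁, hε₁, hε₁u⟩ := Metric.mem_nhds_iff.1 hu
    obtain ⟨ε₂, hε₂, hε₂ρ⟩ := Metric.mem_nhds_iff.1 (isOpen_ball.mem_nhds k₁.2)
    refine ⟨A₀, hA₀F, (k₁ : K), min ε₁ ε₂, lt_min hε₁ hε₂,
      fun k hk => hε₂ρ (ball_subset_ball (min_le_right _ _) hk), fun k hk => ?_⟩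
    have hkρ : k ∈ ball (0 : K) ρ := hε₂ρ (ball_subset_ball (min_le_right _ _) hk)
    have hku : k ∈ u := hε₁u (ball_subset_ball (min_le_left _ _) hk)
    have hkf : (⟨k, hkρ⟩ : ball (0 : K) ρ) ∈ f ⟨A₀, hA₀F⟩ :=
      huf (show (⟨k, hkρ⟩ : ball (0 : K) ρ) ∈ ((↑) : ball (0 : K) ρ → K) ⁻¹' u from hku)
    -- `Ψ₀ k ∈ closure (↑A₀) ∩ Ω = ↑A₀`, as `A₀` is closed in `Ω`
    have hw : (⟨Ψ₀ k, hΩ_of_ball k hkρ⟩ : Ω) ∈ A₀ := by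
      rw [← (hFan hA₀F).isClosed.closure_eq,
        Topology.IsInducing.subtypeVal.closure_eq_preimage_closure_image]
      exact hkf
    exact ⟨_, hw, rfl⟩
  -- identity principle: the whole chart lies on `A₀`
  have hzero : ∀ k ∈ ball (0 : K) ρ, IsZeroSetAt (((↑) : Ω → V) '' A₀) (Ψ₀ k) := by
    intro k hk
    obtain ⟨⟨w, -, hwk⟩, -⟩ := hballZN k hk
    have h := (hFan hA₀F w).isZeroSetAt_chartImage (I := 𝓘(ℂ, V)) (x := w)
      (by rw [Opens.extChartAt_source]; trivial)
    rwa [Opens.chartImage_eq, Opens.extChartAt_apply, hwk] at h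
  have hall : ∀ k ∈ ball (0 : K) ρ, Ψ₀ k ∈ ((↑) : Ω → V) '' A₀ :=
    SCV.forall_mem_of_isZeroSetAt_of_ball_subset hΨ hzero hε hsub hin
  -- off the other components (an `𝓗^{2p}`-null set), the density is `mult A₀`
  refine ⟨T.mult A₀, ?_⟩
  have hbad : ∀ y ∈ T.carrier ∩ N, T.density y ≠ T.mult A₀ →
      y ∈ ⋃ A ∈ F.erase A₀, ((↑) : Ω → V) '' (A ∩ A₀) := by
    intro y hy hne
    rw [hcarN, ← himage] at hy
    obtain ⟨k, hk, rfl⟩ := hy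
    obtain ⟨w, hwA₀, hwk⟩ := hall k hk
    rw [← hwk, density_apply_coe] at hne
    by_contra hcon
    refine hne (multAt_eq_mult hwA₀ fun A' hA' hwA' => ?_)
    by_contra hAA
    refine hcon (mem_iUnion₂.2 ⟨A', Finset.mem_erase.2 ⟨hAA, hFmem.2 ⟨hA', w, ?_, hwA'⟩⟩,
      ⟨w, ⟨hwA', hwA₀⟩, hwk⟩⟩)
    show (w : V) ∈ Kc
    rw [hwk]; exact hNK (hballZN k hk).2
  have hnull : (μHE[2 * p] : Measure V) (⋃ A ∈ F.erase A₀, ((↑) : Ω → V) '' (A ∩ A₀)) = 0 := by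
    refine (measure_biUnion_null_iff (F.erase A₀).countable_toSet).2 fun A hA => ?_
    obtain ⟨hAA, hAF⟩ := Finset.mem_erase.1 hA
    have hA' := (hFmem.1 hAF).1
    have hA₀' := (hFmem.1 hA₀F).1
    have hpn : p ≤ Module.finrank ℂ V := (T.hasPureDim_of_mult_ne_zero hA').le_finrank
    exact (T.isIrreducibleAnalyticSet_of_mult_ne_zero hA').euclideanHausdorffMeasure_image_inter_eq_zero
      (T.isIrreducibleAnalyticSet_of_mult_ne_zero hA₀') (c₀ := Module.finrank ℂ V - p) (by omega)
      (T.hasPureDim_of_mult_ne_zero hA').hasPureCodim (T.hasPureDim_of_mult_ne_zero hA₀').hasPureCodim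
      hAA
  have hM : MeasurableSet (T.carrier ∩ N) := T.measurableSet_carrier.inter hNo.measurableSet
  rw [ae_restrict_iff' hM]
  filter_upwards [measure_eq_zero_iff_ae_notMem.1 hnull] with y hy hyM
  by_contra hne
  exact hy (hbad y hyM hne)

/-- **The orientation frame along a straightened chart**: in the situation of
`approxTangentCone_eq_range_of_chart`, at every point `Ψ₀ k` of the chart the orientation frame
`ξ_T` of `[T]` is the real `2p`-frame `(u₀, I u₀, …)` of a unitary `p`-frame `u` of the tangent
space `im DΨ₀(k)`. [cite: Harvey1977, Appendix Def. A.2; Chirka1989, §14.1, p. 174] -/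
theorem exists_orientationFrame_eq_complexFrame_of_chart (T : HolomorphicChain 𝓘(ℂ, V) Ω p)
    {N : Set V} {g : V → (Fin (Module.finrank ℂ V - p) → ℂ)} {K : Submodule ℂ V} {π : V →L[ℂ] K}
    {ρ : ℝ} {Ψ₀ : K → V} {x₀ : V} (hNo : IsOpen N) (hg : DifferentiableOn ℂ g N)
    (hgZ : ∀ z ∈ N, z ∈ ((↑) : Ω → V) '' T.support ↔ g z = 0)
    (hsurj : ∀ z ∈ N, Function.Surjective (fderiv ℂ g z))
    (hrank : Module.finrank ℂ K + (Module.finrank ℂ V - p) = Module.finrank ℂ V)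
    (hKp : Module.finrank ℂ K = p) (hΨ : DifferentiableOn ℂ Ψ₀ (ball 0 ρ))
    (himage : Ψ₀ '' ball 0 ρ = ((↑) : Ω → V) '' T.support ∩ N)
    (hπ : ∀ k ∈ ball (0 : K) ρ, π (Ψ₀ k - x₀) = k) {k : K} (hk : k ∈ ball (0 : K) ρ) :
    ∃ u : Fin p → V, Orthonormal ℂ u ∧
      ((Submodule.span ℝ (Set.range (complexFrame u)) : Set V) =
        (LinearMap.range (fderiv ℂ Ψ₀ k : K →ₗ[ℂ] V) : Set V)) ∧
      T.orientationFrame (Ψ₀ k) = complexFrame u := by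
  classical
  have hcone := T.approxTangentCone_eq_range_of_chart hNo hg hgZ hsurj hrank hKp hΨ himage hπ hk
  have hcarN : T.carrier ∩ N = ((↑) : Ω → V) '' T.support ∩ N :=
    T.carrier_inter_eq_of_chart hNo hg hgZ hsurj
  have hkcar : Ψ₀ k ∈ T.carrier := by
    have : Ψ₀ k ∈ ((↑) : Ω → V) '' T.support ∩ N := himage ▸ mem_image_of_mem Ψ₀ hk
    rw [← hcarN] at this
    exact this.1
  obtain ⟨u, hu, hspan⟩ := T.exists_orthonormal_span_eq_approxTangentCone hkcar
  have h : ∃ u : Fin p → V, Orthonormal ℂ u ∧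
      ((Submodule.span ℝ (Set.range (complexFrame u)) : Set V) =
        approxTangentCone (2 * p) ((μHE[2 * p] : Measure V).restrict T.carrier) (Ψ₀ k)) :=
    ⟨u, hu, hspan⟩
  refine ⟨h.choose, h.choose_spec.1, h.choose_spec.2.trans hcone, ?_⟩
  unfold HolomorphicChain.orientationFrame
  simp only [dif_pos h]


/-! ### `d[T] = 0` near the regular points -/

/-- **The formula for `d[T]`**: for a holomorphic `(q+1)`-chain `T` and a test `(2q+1)`-form `ψ`,
`d[T](ψ) = [T](dψ) = ∫_{reg |T|} θ_T · dψ(ξ_T) d𝓗^{2q+2}` — the integral formula for the current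
of integration `[T]` holds because, by Lelong's theorem
(`Lelong1957_hausdorffMeasure_inter_lt_top_holds`), its density is locally summable
(`locallyIntegrableOn_of_lelong`). [cite: Harvey1977, Lemma 1.3 and §1.3; Chirka1989, §14.2] -/
theorem boundary_apply_eq_setIntegral {q : ℕ} (T : HolomorphicChain 𝓘(ℂ, V) Ω (q + 1))
    (ψ : TestForm Ω (2 * q + 1)) :
    T.boundary ψ = ∫ y in T.carrier, (T.density y : ℝ) * (extDeriv ⇑ψ y) (T.orientationFrame y)
      ∂(μHE[2 * q + 1 + 1] : Measure V) := by
  have hli : LocallyIntegrableOn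
      (fun x => (T.density x : ℝ) • frameVector (T.orientationFrame x : Fin (2 * q + 1 + 1) → V))
      (Ω : Set V) ((μHE[2 * q + 1 + 1] : Measure V).restrict T.carrier) :=
    T.locallyIntegrableOn_of_lelong Lelong1957_hausdorffMeasure_inter_lt_top_holds
  show (currentOfIntegration T.carrier T.density
      (T.orientationFrame : V → Fin (2 * q + 1 + 1) → V) : Current Ω (2 * q + 1 + 1))
      (TestForm.extDerivCLM ψ) = _
  rw [currentOfIntegration_apply hli, TestForm.extDerivCLM_apply]
  rfl

open Literature.Analysis.Calculus in
/-- **`d[T](ψ) = 0` for test forms supported near a regular point** — Harvey's "Of course,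
`dT = 0` on `Ω - Sing V`" [Harvey1977, proof of Lemma 1.8], for the current
`[T] = ∫_{reg|T|} θ_T ⟨·, ξ_T⟩ d𝓗^{2p}` of a holomorphic `p`-chain, `p = q + 1`: every point `x₀` of
the carrier `reg |T|` has a neighbourhood `U` (the domain `N` of a straightened chart
`Ψ₀ : B → |T| ∩ N`) such that `d[T](ψ) = [T](dψ) = 0` whenever `spt ψ ⊆ U`. Computation:
`[T](dψ) = ∫_{reg|T| ∩ N} θ_T dψ(ξ_T) d𝓗^{2p}` (Lelong: the density is locally summable,
`locallyIntegrableOn_of_lelong`) `= k₀ ∫_{Ψ₀(B)} dψ(ξ_T) d𝓗^{2p}` (`θ_T = k₀` a.e.,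
`exists_ae_density_eq_of_chart`) `= k₀ ∫_B J(DΨ₀) dψ(ξ_T ∘ Ψ₀) dk` (area formula,
`integral_image_eq_integral_normDet_smul`) `= k₀ ∫_B (Ψ₀^* dψ)(e) dk` (canonical orientation:
`J(DΨ₀(k)) dψ(ξ_T(Ψ₀ k)) = dψ(DΨ₀(k) ∘ e)` for the real frame `e` of a unitary basis of `K`,
`apply_comp_complexFrame_eq_normDet_mul`) `= 0` (Stokes on `K ≅ ℝ^{2p}` for the compactly supported
form `Ψ₀^*ψ`, `integral_extDeriv_pullback_eq_zero`). [cite: Harvey1977, Lemma 1.8 (proof, p. 320);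
Chirka1989, §14.2 Prop. 3] -/
theorem exists_nhds_boundary_apply_eq_zero {q : ℕ} (T : HolomorphicChain 𝓘(ℂ, V) Ω (q + 1))
    {x₀ : V} (hx₀ : x₀ ∈ T.carrier) :
    ∃ U ∈ 𝓝 x₀, ∀ ψ : TestForm Ω (2 * q + 1), tsupport ⇑ψ ⊆ U → T.boundary ψ = 0 := by
  classical
  haveI : ProperSpace V := FiniteDimensional.proper ℂ V
  haveI : LocallyCompactSpace Ω := Ω.isOpen.locallyCompactSpace
  set n := Module.finrank ℂ V with hn
  set Z : Set V := ((↑) : Ω → V) '' T.support with hZ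
  obtain ⟨hpn, hreg⟩ := T.isRegPt_of_mem_carrier hx₀
  have hx₀Z : x₀ ∈ Z := T.carrier_subset_image_support hx₀
  have hx₀Ω : x₀ ∈ (Ω : Set V) := T.carrier_subset hx₀
  -- a compact ball in `Ω` and a straightened chart inside it
  obtain ⟨r, hr, hrΩ⟩ := Metric.nhds_basis_closedBall.mem_iff.1 (Ω.isOpen.mem_nhds hx₀Ω)
  obtain ⟨N, g, K, π, ρ, Ψ₀, hNo, hx₀N, hNB, hg, hgZ, hsurj, hrank, hρ, hΨ, -, himage, hπ⟩ :=
    hreg.exists_straightParam hx₀Z (ball_mem_nhds x₀ hr)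
  have hKp : Module.finrank ℂ K = q + 1 := by omega
  have hNK : N ⊆ closedBall x₀ r := hNB.trans ball_subset_closedBall
  refine ⟨N, hNo.mem_nhds hx₀N, fun ψ hψN => ?_⟩
  -- chart bookkeeping
  have hcarN : T.carrier ∩ N = Z ∩ N := T.carrier_inter_eq_of_chart hNo hg hgZ hsurj
  have hballZN : ∀ k ∈ ball (0 : K) ρ, Ψ₀ k ∈ Z ∩ N := fun k hk =>
    himage ▸ mem_image_of_mem Ψ₀ hk
  have himN : ∀ k ∈ ball (0 : K) ρ, Ψ₀ k ∈ N := fun k hk => (hballZN k hk).2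
  have hg0 : ∀ k ∈ ball (0 : K) ρ, g (Ψ₀ k) = 0 := fun k hk =>
    (hgZ _ (hballZN k hk).2).1 (hballZN k hk).1
  have hZcl : ∀ y ∈ (Ω : Set V), y ∈ closure Z → y ∈ Z := fun y hyΩ hyZ => by
    have hw : (⟨y, hyΩ⟩ : Ω) ∈ T.support := by
      rw [← T.isClosed_support.closure_eq,
        Topology.IsInducing.subtypeVal.closure_eq_preimage_closure_image]
      exact hyZ
    exact ⟨_, hw, rfl⟩
  -- (1) `d[T](ψ) = [T](dψ) = ∫_{reg|T|} θ_T dψ(ξ_T) d𝓗^{2p}` (Lelong)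
  rw [boundary_apply_eq_setIntegral]
  -- (2) localise to `reg|T| ∩ N`: `dψ = 0` off `spt ψ ⊆ N`
  have h1 : ∫ y in T.carrier, (T.density y : ℝ) * (extDeriv ⇑ψ y) (T.orientationFrame y)
        ∂(μHE[2 * q + 1 + 1] : Measure V) =
      ∫ y in T.carrier ∩ N, (T.density y : ℝ) * (extDeriv ⇑ψ y) (T.orientationFrame y)
        ∂(μHE[2 * q + 1 + 1] : Measure V) := by
    refine setIntegral_eq_of_subset_of_forall_sdiff_eq_zero T.measurableSet_carrier
      inter_subset_left ?_
    rintro y ⟨hy, hyN⟩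
    have hyN' : y ∉ tsupport ⇑ψ := fun h => hyN ⟨hy, hψN h⟩
    simp [TestForm.extDeriv_eq_zero_of_notMem_tsupport ψ hyN']
  -- (3) the density is a.e. the constant `k₀` on the chart
  obtain ⟨k₀, hk₀⟩ := T.exists_ae_density_eq_of_chart hNo hg hgZ hsurj hρ hΨ himage
    (isCompact_closedBall x₀ r) hrΩ hNK
  have hk₀' : ∀ᵐ y ∂((μHE[2 * q + 1 + 1] : Measure V).restrict (T.carrier ∩ N)),
      T.density y = k₀ := hk₀
  have h2 : ∫ y in T.carrier ∩ N, (T.density y : ℝ) * (extDeriv ⇑ψ y) (T.orientationFrame y)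
        ∂(μHE[2 * q + 1 + 1] : Measure V) =
      (k₀ : ℝ) * ∫ y in T.carrier ∩ N, (extDeriv ⇑ψ y) (T.orientationFrame y)
        ∂(μHE[2 * q + 1 + 1] : Measure V) := by
    rw [← integral_const_mul]
    refine integral_congr_ae ?_
    filter_upwards [hk₀'] with y hy
    rw [hy]
  -- (4) area formula along the chart `Ψ₀ : B → reg|T| ∩ N`
  letI iV : InnerProductSpace ℝ V := InnerProductSpace.complexToReal
  letI iK : InnerProductSpace ℝ K := InnerProductSpace.complexToReal
  have hK2 : Module.finrank ℝ K = 2 * q + 1 + 1 := by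
    have h : Module.finrank ℝ K = 2 * Module.finrank ℂ K := finrank_real_of_complex K
    omega
  set D : K → K →L[ℝ] V := fun k => (fderiv ℂ Ψ₀ k).restrictScalars ℝ with hD
  have hDf : ∀ k ∈ ball (0 : K) ρ, HasFDerivWithinAt Ψ₀ (D k) (ball 0 ρ) k := fun k hk =>
    ((hΨ.differentiableAt (isOpen_ball.mem_nhds hk)).hasFDerivAt.restrictScalars ℝ).hasFDerivWithinAt
  have hfd : ∀ k ∈ ball (0 : K) ρ, fderiv ℝ Ψ₀ k = D k := fun k hk =>
    ((hΨ.differentiableAt (isOpen_ball.mem_nhds hk)).hasFDerivAt.restrictScalars ℝ).fderiv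
  have hDinj : ∀ k ∈ ball (0 : K) ρ, Injective (D k) := fun k hk => by
    obtain ⟨hid, -, -⟩ := SCV.straightParam_fderiv hNo hg hsurj hrank hΨ himN hg0 hπ hk
    intro a b hab
    have ha := congrArg (fun f : K →L[ℂ] K => f a) hid
    have hb := congrArg (fun f : K →L[ℂ] K => f b) hid
    simp only [ContinuousLinearMap.comp_apply, ContinuousLinearMap.id_apply] at ha hb
    have hab' : fderiv ℂ Ψ₀ k a = fderiv ℂ Ψ₀ k b := hab
    rw [← ha, ← hb, hab']
  have hInjOn : InjOn Ψ₀ (ball (0 : K) ρ) := fun a ha b hb hab => by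
    rw [← hπ a ha, ← hπ b hb, hab]
  have h3 : ∫ y in T.carrier ∩ N, (extDeriv ⇑ψ y) (T.orientationFrame y)
        ∂(μHE[2 * q + 1 + 1] : Measure V) =
      ∫ k in ball (0 : K) ρ, ((D k : K →L[ℝ] V) : K →ₗ[ℝ] V).normDet •
        (extDeriv ⇑ψ (Ψ₀ k)) (T.orientationFrame (Ψ₀ k)) := by
    rw [hcarN, ← himage]
    have hAF := integral_image_eq_integral_normDet_smul (V := V) measurableSet_ball hDf hDinj hInjOn
      (fun y => (extDeriv ⇑ψ y) (T.orientationFrame y))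
    rw [hK2] at hAF
    simpa only using hAF
  -- (5) the canonical orientation: `J(DΨ₀) dψ(ξ_T ∘ Ψ₀) = (Ψ₀^* dψ)(e)`, `e` the real frame of a
  -- unitary basis `b` of `K`
  set b : OrthonormalBasis (Fin (q + 1)) ℂ K := (stdOrthonormalBasis ℂ K).reindex (finCongr hKp)
    with hb
  have hpt : ∀ k ∈ ball (0 : K) ρ,
      ((D k : K →L[ℝ] V) : K →ₗ[ℝ] V).normDet • (extDeriv ⇑ψ (Ψ₀ k)) (T.orientationFrame (Ψ₀ k)) =
        ((extDeriv ⇑ψ (Ψ₀ k)).compContinuousLinearMap (fderiv ℝ Ψ₀ k)) (complexFrame ⇑b) := by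
    intro k hk
    obtain ⟨u, hu, hspan, hξ⟩ := T.exists_orientationFrame_eq_complexFrame_of_chart hNo hg hgZ
      hsurj hrank hKp hΨ himage hπ hk
    have hspan' : ((Submodule.span ℝ (Set.range (complexFrame u)) : Submodule ℝ V) : Set V) =
        Set.range ⇑(fderiv ℂ Ψ₀ k) := hspan.trans (LinearMap.coe_range _)
    have hR5 := apply_comp_complexFrame_eq_normDet_mul (p := q + 1) b (fderiv ℂ Ψ₀ k) hu hspan'
      (extDeriv ⇑ψ (Ψ₀ k))
    rw [ContinuousAlternatingMap.compContinuousLinearMap_apply, hfd k hk, hξ, smul_eq_mul]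
    exact hR5.symm
  -- (6) Stokes for the compactly supported exact form `d(Ψ₀^*ψ)` on `K`
  have hΨ2 : ContDiffOn ℝ 2 Ψ₀ (ball (0 : K) ρ) :=
    (Literature.Analysis.Complex.SCV.contDiffOn_nat hΨ isOpen_ball 2).restrict_scalars ℝ
  have hψ1 : ContDiff ℝ 1 ⇑ψ := ψ.contDiff.of_le (by exact_mod_cast le_top)
  set C : Set K := (fun y => π (y - x₀)) '' (tsupport ⇑ψ ∩ closure Z) with hC
  have hCc : IsCompact C :=
    (ψ.hasCompactSupport.isCompact.inter_right isClosed_closure).image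
      (π.continuous.comp (continuous_id.sub continuous_const))
  have hCB : C ⊆ ball (0 : K) ρ := by
    rintro _ ⟨y, ⟨hyψ, hyZ⟩, rfl⟩
    have hy : y ∈ Z ∩ N := ⟨hZcl y (ψ.tsupport_subset hyψ) hyZ, hψN hyψ⟩
    rw [← himage] at hy
    obtain ⟨k, hk, rfl⟩ := hy
    show π (Ψ₀ k - x₀) ∈ ball (0 : K) ρ
    rw [hπ k hk]; exact hk
  have hvan : ∀ k ∈ ball (0 : K) ρ, k ∉ C → ⇑ψ (Ψ₀ k) = 0 := fun k hk hkC => by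
    by_contra hne
    exact hkC ⟨Ψ₀ k, ⟨subset_tsupport _ (Function.mem_support.2 hne),
      subset_closure (hballZN k hk).1⟩, hπ k hk⟩
  have hSt := integral_extDeriv_pullback_eq_zero (volume : Measure K) isOpen_ball hΨ2 hψ1 hCc hCB
    hvan (complexFrame ⇑b)
  have h4 : ∫ k in ball (0 : K) ρ, ((D k : K →L[ℝ] V) : K →ₗ[ℝ] V).normDet •
      (extDeriv ⇑ψ (Ψ₀ k)) (T.orientationFrame (Ψ₀ k)) = 0 := by
    rw [setIntegral_congr_fun measurableSet_ball hpt]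
    exact hSt
  rw [h1, h2, h3, h4, mul_zero]

end HolomorphicChain

end Literature.Geometry.Kaehler
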